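import Summits.Ventures.HodgeRepro.Primitive
import Summits.Ventures.HodgeRepro.CMTypeCount

/-!
# CM types invariant under an involution: there are `2^(m/2)` of them (seat `p1`, gen 5)

Blind re-derivation cell `pub-hodge-repro`.  Continues `CMTypeCount.lean` (`#cmTypes = 2^m`, `m = |G|/2`).  Let `g`
be an involution of `G` other than the complex conjugation `c`.  A CM type `Φ` with `Φ·g = Φ` (`rmul Φ g = Φ`) is
*induced from the index-two CM subfield* fixed by `g`; Lemma 2 (iii) of `proofs/P1.md` §8 counts them: the Klein group
`⟨c, g⟩` (`c` acting on the left, `g` on the right) acts freely on `G`, a `g`-invariant CM type picks one of the two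
`g`-cosets in each of the `m/2` orbits `{x, c x, x g, c x g}`, so there are `2^(m/2)` of them.

* `even_card_of_rmul_eq` / `card_filter_rmul_eq_self_powerset` — a `g`-stable finset `s` has even cardinality and
  its `g`-invariant subsets number `2^(|s|/2)` (strong induction, removing one orbit `{x, x g}` at a time);
* `exists_isCMType_rmul_eq` — a `g`-invariant CM type exists (in each orbit `{x, c x, x g, c x g}` take the `g`-coset
  containing the first element under an enumeration of `G`);
* `invCMTypes c g` — the `g`-invariant CM types; **`card_invCMTypes`** — there are `2^((|G|/2)/2)` of them
  (`Φ ↦ Φ ∩ Φ₀` is a bijection onto the `g`-invariant subsets of a `g`-invariant CM type `Φ₀`);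
* `even_half_card_of_involution` — such a `g` forces `m = |G|/2` to be even (`4 ∣ |G|`).

The sealed census has `ι·(m/2)·2^((m−2)/2)` squares with non-trivial stabiliser, `ι` the number of involutions
other than `c`; `FixCount.lean` derives this from the present count.
-/

open Finset

namespace HodgeRepro

variable {G : Type*} [Group G] [DecidableEq G]

/-! ### Right multiplication by an involution -/

omit [DecidableEq G] in
/-- If `T·g = T` then `T` is closed under `x ↦ x g`. -/
theorem mul_mem_of_rmul_eq {T : Finset G} {g : G} (hT : rmul T g = T) {x : G} (hx : x ∈ T) : x * g ∈ T := by
  rw [← hT]; exact mul_mem_rmul hx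

omit [DecidableEq G] in
/-- If `T·g = T` and `x g ∈ T` then `x ∈ T`. -/
theorem mem_of_mul_mem_of_rmul_eq {T : Finset G} {g : G} (hT : rmul T g = T) {x : G} (hx : x * g ∈ T) : x ∈ T := by
  rw [← hT, mem_rmul, mul_inv_cancel_right] at hx; exact hx

omit [DecidableEq G] in
/-- For an involution `g`, `T·g = T` iff `T` is closed under `x ↦ x g`. -/
theorem rmul_eq_self_iff_of_involution {g : G} (hg : g * g = 1) (T : Finset G) :
    rmul T g = T ↔ ∀ x ∈ T, x * g ∈ T := by
  constructor
  · intro hT x hx; exact mul_mem_of_rmul_eq hT hx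
  · intro h
    ext x
    rw [mem_rmul, inv_eq_of_mul_eq_one_right hg]
    constructor
    · intro hx
      have := h _ hx
      rwa [mul_assoc, hg, mul_one] at this
    · exact h x

omit [DecidableEq G] in
/-- An involution `g ≠ 1` moves every element. -/
theorem mul_ne_self_of_ne_one {g : G} (hg1 : g ≠ 1) (x : G) : x * g ≠ x := by
  intro h
  exact hg1 (mul_left_cancel (h.trans (mul_one x).symm))

/-! ### Invariant subsets of a finset under a fixed-point-free involution -/

/-- The `g`-invariant subsets of `s \ {x, x g}` are the `g`-invariant subsets of `s` not containing `x`. -/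
theorem filter_rmul_eq_self_sdiff {g : G} (hg : g * g = 1) {s : Finset G} {x : G} (hx : x ∈ s) :
    ((s \ {x, x * g}).powerset.filter fun T => rmul T g = T) =
      (s.powerset.filter fun T => rmul T g = T).filter fun T => x ∉ T := by
  ext T
  simp only [mem_filter, mem_powerset]
  constructor
  · rintro ⟨hT, hTg⟩
    refine ⟨⟨hT.trans sdiff_subset, hTg⟩, fun hxT => ?_⟩
    have := hT hxT
    rw [mem_sdiff] at this
    exact this.2 (mem_insert_self _ _)
  · rintro ⟨⟨hT, hTg⟩, hxT⟩
    refine ⟨fun y hy => ?_, hTg⟩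
    rw [mem_sdiff, mem_insert, mem_singleton]
    refine ⟨hT hy, ?_⟩
    rintro (rfl | rfl)
    · exact hxT hy
    · apply hxT
      have := mul_mem_of_rmul_eq hTg hy
      rwa [mul_assoc, hg, mul_one] at this

/-- Removing the orbit `{x, x g}` from a `g`-stable finset leaves a `g`-stable finset. -/
theorem rmul_sdiff_pair_eq_self {g : G} (hg : g * g = 1) {s : Finset G} (hs : rmul s g = s) (x : G) :
    rmul (s \ {x, x * g}) g = s \ {x, x * g} := by
  rw [rmul_eq_self_iff_of_involution hg]
  intro y hy
  rw [mem_sdiff] at hy ⊢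
  refine ⟨mul_mem_of_rmul_eq hs hy.1, fun hyB => hy.2 ?_⟩
  rw [mem_insert, mem_singleton] at hyB ⊢
  rcases hyB with h | h
  · right; rw [← h, mul_assoc, hg, mul_one]
  · left; exact mul_right_cancel h

/-- The orbit `{x, x g}` of a point of a `g`-stable finset lies in it. -/
theorem pair_subset_of_rmul_eq {g : G} {s : Finset G} (hs : rmul s g = s) {x : G} (hx : x ∈ s) :
    ({x, x * g} : Finset G) ⊆ s := by
  rw [insert_subset_iff, singleton_subset_iff]
  exact ⟨hx, mul_mem_of_rmul_eq hs hx⟩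

/-- `|s \ {x, x g}| + 2 = |s|` for `x ∈ s`, `s` `g`-stable and `g ≠ 1` an involution. -/
theorem card_sdiff_pair_add_two {g : G} (hg1 : g ≠ 1) {s : Finset G} (hs : rmul s g = s) {x : G} (hx : x ∈ s) :
    (s \ {x, x * g}).card + 2 = s.card := by
  have hBs := pair_subset_of_rmul_eq hs hx
  have h2 : ({x, x * g} : Finset G).card = 2 := card_pair_eq_two_iff.2 (mul_ne_self_of_ne_one hg1 x).symm
  have := card_le_card hBs
  rw [card_sdiff_of_subset hBs, h2]
  rw [h2] at this
  omega

/-- A `g`-stable finset has even cardinality (`g ≠ 1` an involution): it is a union of orbits `{x, x g}`. -/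
theorem even_card_of_rmul_eq {g : G} (hg : g * g = 1) (hg1 : g ≠ 1) :
    ∀ s : Finset G, rmul s g = s → Even s.card := by
  intro s
  induction s using Finset.strongInduction with
  | H s ih =>
    intro hs
    rcases s.eq_empty_or_nonempty with rfl | ⟨x, hx⟩
    · simp
    · have hsub : s \ {x, x * g} ⊂ s :=
        sdiff_ssubset (pair_subset_of_rmul_eq hs hx) ⟨x, mem_insert_self _ _⟩
      have := ih _ hsub (rmul_sdiff_pair_eq_self hg hs x)
      rw [← card_sdiff_pair_add_two hg1 hs hx]
      exact this.add even_two

/-- **Invariant subsets under a fixed-point-free involution.** If `g` is an involution `≠ 1` and `s·g = s`, then the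
subsets `T ⊆ s` with `T·g = T` number `2^(|s|/2)`. -/
theorem card_filter_rmul_eq_self_powerset {g : G} (hg : g * g = 1) (hg1 : g ≠ 1) :
    ∀ s : Finset G, rmul s g = s → (s.powerset.filter fun T => rmul T g = T).card = 2 ^ (s.card / 2) := by
  intro s
  induction s using Finset.strongInduction with
  | H s ih =>
    intro hs
    rcases s.eq_empty_or_nonempty with rfl | ⟨x, hx⟩
    · rw [powerset_empty, filter_singleton, if_pos hs, card_singleton, card_empty]
      norm_num
    · -- remove the orbit `{x, x g}`
      set B : Finset G := {x, x * g} with hB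
      have hBs : B ⊆ s := pair_subset_of_rmul_eq hs hx
      set s' := s \ B with hs'
      have hsub : s' ⊂ s := sdiff_ssubset hBs ⟨x, mem_insert_self _ _⟩
      have hs'g : rmul s' g = s' := rmul_sdiff_pair_eq_self hg hs x
      have hcard : s'.card + 2 = s.card := card_sdiff_pair_add_two hg1 hs hx
      -- split the invariant subsets of `s` by whether they contain `x`
      have hsplit := card_filter_add_card_filter_not (s := s.powerset.filter fun T => rmul T g = T)
        (fun T => x ∉ T)
      have hA : ((s.powerset.filter fun T => rmul T g = T).filter fun T => x ∉ T).card =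
          2 ^ (s'.card / 2) := by
        rw [← filter_rmul_eq_self_sdiff hg hx]
        exact ih s' hsub hs'g
      have hB' : ((s.powerset.filter fun T => rmul T g = T).filter fun T => ¬ x ∉ T).card =
          ((s.powerset.filter fun T => rmul T g = T).filter fun T => x ∉ T).card := by
        refine card_bij' (fun T _ => T \ B) (fun T _ => T ∪ B) ?_ ?_ ?_ ?_
        · intro T hT
          simp only [mem_filter, mem_powerset, not_not] at hT ⊢
          exact ⟨⟨sdiff_subset.trans hT.1.1, rmul_sdiff_pair_eq_self hg hT.1.2 x⟩,
            fun h => (mem_sdiff.1 h).2 (mem_insert_self _ _)⟩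
        · intro T hT
          simp only [mem_filter, mem_powerset, not_not] at hT ⊢
          refine ⟨⟨union_subset hT.1.1 hBs, ?_⟩, mem_union_right _ (mem_insert_self _ _)⟩
          rw [rmul_eq_self_iff_of_involution hg]
          intro y hy
          rw [mem_union] at hy ⊢
          rcases hy with hy | hy
          · exact Or.inl (mul_mem_of_rmul_eq hT.1.2 hy)
          · right
            rw [hB, mem_insert, mem_singleton] at hy ⊢
            rcases hy with rfl | rfl
            · right; rfl
            · left; rw [mul_assoc, hg, mul_one]
        · intro T hT
          simp only [mem_filter, mem_powerset, not_not] at hT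
          exact sdiff_union_of_subset (pair_subset_of_rmul_eq hT.1.2 hT.2)
        · intro T hT
          simp only [mem_filter, mem_powerset] at hT
          apply union_sdiff_cancel_right
          rw [disjoint_left]
          intro y hy hyB
          apply hT.2
          rw [hB, mem_insert, mem_singleton] at hyB
          rcases hyB with rfl | rfl
          · exact hy
          · exact mem_of_mul_mem_of_rmul_eq hT.1.2 hy
      rw [← hsplit, hB', hA, ← hcard]
      have : (s'.card + 2) / 2 = s'.card / 2 + 1 := by omega
      rw [this, pow_succ]; ring

/-! ### `g`-invariant CM types -/

variable [Fintype G]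

omit [DecidableEq G] in
/-- **A `g`-invariant CM type exists** for every involution `g ∉ {1, c}`: in each orbit `{x, c x, x g, c x g}` of the
Klein group `⟨c, g⟩` take the `g`-coset whose first element under an enumeration of `G` comes first. -/
theorem exists_isCMType_rmul_eq {c : G} (hc : IsComplexConj c) {g : G} (hg : g * g = 1) (hgc : g ≠ c) :
    ∃ Φ : Finset G, IsCMType c Φ ∧ rmul Φ g = Φ := by
  let e := Fintype.equivFin G
  let f : G → ℕ := fun x => min (e x : ℕ) (e (x * g) : ℕ)
  have hf : ∀ x, f (x * g) = f x := by
    intro x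
    simp only [f]
    rw [mul_assoc, hg, mul_one, min_comm]
  have hfc : ∀ x, f x ≠ f (c * x) := by
    intro x h
    -- the four elements `x, x g, c x, c x g` are pairwise distinct, so the minima differ
    have hval : ∀ a b : G, (e a : ℕ) = e b → a = b := fun a b h => e.injective (Fin.ext h)
    have h1 : x ≠ c * x := (hc.mul_ne_self x).symm
    have h2 : x ≠ c * x * g := by
      intro h'
      apply hgc
      have : x * g = c * x * g * g := by rw [← h']
      rw [mul_assoc, hg, mul_one] at this
      have h3 : x * g = x * c := by rw [this, hc.comm]
      exact mul_left_cancel h3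
    have h3 : x * g ≠ c * x := by
      intro h'
      apply hgc
      have : x * g = x * c := by rw [h', hc.comm]
      exact mul_left_cancel this
    have h4 : x * g ≠ c * x * g := fun h' => h1 (mul_right_cancel h')
    simp only [f] at h
    rcases min_choice (e x : ℕ) (e (x * g) : ℕ) with ha | ha <;>
      rcases min_choice (e (c * x) : ℕ) (e (c * x * g) : ℕ) with hb | hb <;> rw [ha, hb] at h
    · exact h1 (hval _ _ h)
    · exact h2 (hval _ _ h)
    · exact h3 (hval _ _ h)
    · exact h4 (hval _ _ h)
  refine ⟨univ.filter fun x => f x < f (c * x), fun x => ?_, ?_⟩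
  · simp only [mem_filter, mem_univ, true_and, hc.mul_mul_cancel]
    have hne := hfc x
    constructor
    · intro h1 h2; exact absurd (h1.trans h2) (lt_irrefl _)
    · intro h
      rcases lt_or_gt_of_ne hne with h' | h'
      · exact h'
      · exact absurd h' h
  · rw [rmul_eq_self_iff_of_involution hg]
    intro x hx
    simp only [mem_filter, mem_univ, true_and] at hx ⊢
    rw [hf, ← mul_assoc, hf]
    exact hx

/-- The `g`-invariant CM types of `(G, c)`. -/
def invCMTypes (c g : G) : Finset (Finset G) := (cmTypes c).filter fun Φ => rmul Φ g = Φ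

/-- Membership in `invCMTypes`. -/
theorem mem_invCMTypes {c g : G} {Φ : Finset G} : Φ ∈ invCMTypes c g ↔ IsCMType c Φ ∧ rmul Φ g = Φ := by
  simp [invCMTypes, mem_cmTypes]

omit [Fintype G] in
/-- `typeOfChoice c Φ₀ (Φ ∩ Φ₀) = Φ` for CM types `Φ, Φ₀` (the inverse law of `card_cmTypes_eq_two_pow`). -/
theorem typeOfChoice_inter_self {c : G} (hc : IsComplexConj c) {Φ₀ Φ : Finset G} (hΦ₀ : IsCMType c Φ₀)
    (hΦ : IsCMType c Φ) : typeOfChoice c Φ₀ (Φ ∩ Φ₀) = Φ := by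
  ext x
  rw [mem_typeOfChoice hc, mem_inter, mem_inter]
  have h0 := hΦ₀ x
  have h1 := hΦ x
  by_cases hx : x ∈ Φ₀
  · have hcx : c * x ∉ Φ₀ := h0.1 hx
    constructor
    · rintro (⟨h, -⟩ | ⟨h, -⟩)
      · exact h
      · exact absurd h hcx
    · intro h; exact Or.inl ⟨h, hx⟩
  · have hcx : c * x ∈ Φ₀ := by
      by_contra h'
      exact hx (h0.2 h')
    constructor
    · rintro (⟨-, h⟩ | ⟨-, h⟩)
      · exact absurd h hx
      · exact h1.2 fun hc' => h ⟨hc', hcx⟩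
    · intro h
      right
      exact ⟨hcx, fun h' => h1.1 h h'.1⟩

omit [Fintype G] in
/-- `typeOfChoice c Φ₀ T ∩ Φ₀ = T` for `T ⊆ Φ₀` (the other inverse law). -/
theorem typeOfChoice_inter {c : G} (hc : IsComplexConj c) {Φ₀ T : Finset G} (hΦ₀ : IsCMType c Φ₀) (hT : T ⊆ Φ₀) :
    typeOfChoice c Φ₀ T ∩ Φ₀ = T := by
  ext x
  rw [mem_inter, mem_typeOfChoice hc]
  have h0 := hΦ₀ x
  constructor
  · rintro ⟨h | ⟨h, -⟩, hx⟩
    · exact h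
    · exact absurd h (h0.1 hx)
  · intro h
    exact ⟨Or.inl h, hT h⟩

omit [Fintype G] in
/-- `typeOfChoice c Φ₀ T` is `g`-invariant when `Φ₀` and `T` are (`g` an involution). -/
theorem rmul_typeOfChoice_eq {c : G} (hc : IsComplexConj c) {g : G} (hg : g * g = 1) {Φ₀ T : Finset G}
    (hΦ₀ : rmul Φ₀ g = Φ₀) (hT : rmul T g = T) : rmul (typeOfChoice c Φ₀ T) g = typeOfChoice c Φ₀ T := by
  rw [rmul_eq_self_iff_of_involution hg]
  intro y hy
  rw [mem_typeOfChoice hc] at hy ⊢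
  rcases hy with hy | ⟨hy1, hy2⟩
  · exact Or.inl (mul_mem_of_rmul_eq hT hy)
  · right
    rw [← mul_assoc]
    exact ⟨mul_mem_of_rmul_eq hΦ₀ hy1, fun h => hy2 (mem_of_mul_mem_of_rmul_eq hT h)⟩

/-- The `g`-invariant CM types are in bijection with the `g`-invariant subsets of a `g`-invariant CM type `Φ₀`. -/
theorem card_invCMTypes_eq {c : G} (hc : IsComplexConj c) {g : G} (hg : g * g = 1) {Φ₀ : Finset G}
    (hΦ₀ : IsCMType c Φ₀) (hΦ₀g : rmul Φ₀ g = Φ₀) :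
    (invCMTypes c g).card = (Φ₀.powerset.filter fun T => rmul T g = T).card := by
  refine card_bij' (fun Φ _ => Φ ∩ Φ₀) (fun T _ => typeOfChoice c Φ₀ T) ?_ ?_ ?_ ?_
  · intro Φ hΦ
    rw [mem_invCMTypes] at hΦ
    rw [mem_filter, mem_powerset]
    exact ⟨inter_subset_right, by rw [rmul_inter, hΦ.2, hΦ₀g]⟩
  · intro T hT
    rw [mem_filter, mem_powerset] at hT
    rw [mem_invCMTypes]
    exact ⟨isCMType_typeOfChoice hc hΦ₀ hT.1, rmul_typeOfChoice_eq hc hg hΦ₀g hT.2⟩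
  · intro Φ hΦ
    rw [mem_invCMTypes] at hΦ
    exact typeOfChoice_inter_self hc hΦ₀ hΦ.1
  · intro T hT
    rw [mem_filter, mem_powerset] at hT
    exact typeOfChoice_inter hc hΦ₀ hT.1

/-- **The number of `g`-invariant CM types is `2^(m/2)`**, `m = |G|/2`, for every involution `g ∉ {1, c}`. -/
theorem card_invCMTypes {c : G} (hc : IsComplexConj c) {g : G} (hg : g * g = 1) (hg1 : g ≠ 1) (hgc : g ≠ c) :
    (invCMTypes c g).card = 2 ^ (Fintype.card G / 2 / 2) := by
  obtain ⟨Φ₀, hΦ₀, hΦ₀g⟩ := exists_isCMType_rmul_eq hc hg hgc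
  rw [card_invCMTypes_eq hc hg hΦ₀ hΦ₀g, card_filter_rmul_eq_self_powerset hg hg1 Φ₀ hΦ₀g]
  have := hΦ₀.two_mul_card hc
  congr 2
  omega

/-- **If `G` has an involution other than `c`, then `m = |G|/2` is even** (`4 ∣ |G|`): a `g`-invariant CM type is a
`g`-stable set of `m` elements. -/
theorem even_half_card_of_involution {c : G} (hc : IsComplexConj c) {g : G} (hg : g * g = 1) (hg1 : g ≠ 1)
    (hgc : g ≠ c) : Even (Fintype.card G / 2) := by
  obtain ⟨Φ₀, hΦ₀, hΦ₀g⟩ := exists_isCMType_rmul_eq hc hg hgc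
  have h := even_card_of_rmul_eq hg hg1 Φ₀ hΦ₀g
  have h2 := hΦ₀.two_mul_card hc
  have : Φ₀.card = Fintype.card G / 2 := by omega
  rwa [this] at h

end HodgeRepro
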